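import Summits.QuantumFields.YangMills.Theorems.AlphaInputsT3ACv3AdaptedClassX
import HarnessLib

/-!
# `AlphaInputsT3ACv3SymAvgCoverGeometry` — R3 2′χ (O″χ) B1, the (α)-seam re-reading R-ii, analytic core (69)_sym, PIECE (ii) part 1: **THE COVER `Δ′(p′)` OF A COARSE
# PLAQUETTE — COORDINATES AND LOCALITY** — `Δ′(p′) = B^j(x₀) ∪ B^j(y₀) ∪ B^j(z₀) ∪ B^j(w₀)` (`Carriers.plaqCover`) is the product box of [Balaban1985UV3] (70) based at the lower
# corner of `B^j(p′.src)` (offsets `< side_κ`, the letters of `B10Eq70Squaring.deltaBox`), and the bonds with both ends in it are closed under the EXACT (0.4) dependency, so the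
# `j`-fold averages of record at `∂p′` read only those bonds — lane `pub-balaban3d` ∕ cell `ym3-torus`, seat `ym-ust-19936-w2` (g4)

WHY (★w6-19936 g2 `LOCATE-alpha-seam-w6-g2.md` §2 (ii); ★★OWNER RULING g26-№13 (ii)∕№14 R-ii; LEAD ★w1-19936 g3 B1 PLAN v3).  The seam row of record is (71)_sym per recorded plaquette
(LEAD ✓`SmallFactor71Sym.smallFactor_of_large69_unitary`), whose one new analytic input is (69)_sym; its piece (ii) — the gauge clamp of the sibling `…SymAvgGaugeClamp` — needs two
pieces of bookkeeping about the cover, both «[Balaban1985Averaging] p. 26: it is enough to assume (52) for `p ⊂ B^k(x) ∪ B^k(y) ∪ B^k(z) ∪ B^k(w)`»: WHERE the cover is (a product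
box, so the regional axial gauge `RegionAxialGauge.dist1_gaugeActT_axialT_le_of_box` applies inside it) and WHAT the averaged plaquette reads (only the bonds over the cover, so a
configuration may be clamped to `1` outside).
WHAT IS HERE (def-free; generic `P : Params`; §2 for any `GaugeGroup`∕`LoopAverage`).  §1 `corner_eq_add`, `sum_side_eq` (`Σ_κ side_κ = (d+2)L^j`), ★ `mem_plaqCover_iff_exists_offset`
(`x ∈ Δ′(p′)` iff `x_κ = (p′.src)_κ·L^j + a_κ`, `a_κ < side_κ`; `←` is `TorusLift.projSite_mem_plaqCover`, `→` is `val_coarsen` + the corner labels), `side_le`,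
`two_mul_pow_le_half_sitesPerDir_zero`∕`two_mul_pow_lt_sitesPerDir_zero` (`2L^j ≤ L^{m+K}` for `j < m + K`), `offset_unique`, ★ `mem_plaqsIn_cover_of_offset` (a fine plaquette given by
offsets with room `+1` in its two directions has all corners in `Δ′(p′)` — the membership test piece (iv) needs for the rigid flux family of piece (i)); §2 ★ `depClosed₂_coverBonds`
(«bonds of level `s ≤ j` with both fine representatives in `Δ′(p′)`» is `DepClosed₂`: block saturation via `coarsen_toFine`∕`coarsen_eq_of_coarsen_eq`), ★ `iter_eq_of_eqOn_cover`
(`LocalSmallLoop.iter_blockAvg_local₂` on that family), ★★ `plaqHol_iter_eq_of_eqOn_cover` (two configurations agreeing on the bonds over `Δ′(p′)` have the same `Ū^{(j)}(∂p′)`).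
HONEST FRAMING.  Lattice bookkeeping; nothing of [Balaban1985UV3]∕[Balaban1985Averaging] is asserted beyond what is proved; count-neutral helper toward R3 2′χ (item 19936), registry
untouched; nothing about d = 4, the continuum, or a mass gap; YM₃ on T³ is rung R3 of the programme, NOT the Clay problem.

References: T. Bałaban, Commun. Math. Phys. 102 (1985) 255–275 [Balaban1985UV3] ((69)–(70) p.273); CMP 98 (1985) 17–51 [Balaban1985Averaging] (p.24, Prop. 2 and p.26);
CMP 109 (1987) 249–301 [Balaban1987RG1] ((0.1), (0.4) pp.251–253).
-/

set_option autoImplicit false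

noncomputable section

namespace Summit.QuantumFields.YangMills.Theorems.SymAvgCover

open Literature.MathematicalPhysics.QuantumFieldTheory.Balaban1983to89
open T4Continuum BlockAveraging
open Literature.MathematicalPhysics.QuantumFieldTheory.Balaban1983to89.B10Eq38TorusDomains (toFine toFine_zero cornerSet plaqsIn mem_plaqsIn_iff)
open B10Eq70Squaring (side deltaBox mem_deltaBox)
open Summit.QuantumFields.Balaban3D.Carriers (coarsen plaqCover coarsen_succ)
open Summit.QuantumFields.Balaban3D.Proofs.TorusLift (val_coarsen projSite projSite_apply zOf zOf_apply projSite_mem_plaqCover)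
open Summit.QuantumFields.YangMills.Theorems (coarsen_toFine coarsen_eq_of_coarsen_eq cornerSet_subset_plaqCover)
open Summit.QuantumFields.YangMills.Theorems.LocalSmallLoop (Feeds₂ DepClosed₂ iter_blockAvg_local₂)

variable {P : Params} {j : ℕ}

/-! ## §1 Coordinates of the cover `Δ′(p′)`: lower corner plus bounded offsets -/

/-- The four corners of `p′` differ from `p′.src` by `0∕1` in the two directions of `p′` and by `0` elsewhere. [folklore] -/
theorem corner_eq_add (p : Plaq P j) {c : Site P j}
    (hc : c = p.src ∨ c = p.src.shift p.μ ∨ c = p.src.shift p.ν ∨ c = (p.src.shift p.μ).shift p.ν) :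
    ∃ εμ εν : ℕ, εμ ≤ 1 ∧ εν ≤ 1 ∧ ∀ κ, c κ = p.src κ + ((if κ = p.μ then εμ else if κ = p.ν then εν else 0 : ℕ) : ZMod (P.sitesPerDir j)) := by
  have hμν : p.μ ≠ p.ν := ne_of_lt p.hμν
  rcases hc with rfl | rfl | rfl | rfl
  · exact ⟨0, 0, zero_le_one, zero_le_one, fun κ => by simp⟩
  · refine ⟨1, 0, le_rfl, zero_le_one, fun κ => ?_⟩
    simp only [Site.shift_apply]
    by_cases h1 : κ = p.μ
    · subst h1; simp
    · simp [h1]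
  · refine ⟨0, 1, zero_le_one, le_rfl, fun κ => ?_⟩
    simp only [Site.shift_apply]
    by_cases h1 : κ = p.ν
    · subst h1; simp [hμν.symm]
    · by_cases h2 : κ = p.μ
      · subst h2; simp [hμν]
      · simp [h1, h2]
  · refine ⟨1, 1, le_rfl, le_rfl, fun κ => ?_⟩
    simp only [Site.shift_apply]
    by_cases h1 : κ = p.ν
    · subst h1; simp [hμν.symm]
    · by_cases h2 : κ = p.μ
      · subst h2; simp [hμν]
      · simp [h1, h2]

/-- The total side length of the box `Δ′`: `Σ_κ side_κ = (d + 2)·n` (`2n` twice, `n` in the other `d − 2` directions). [cite: Balaban1985UV3, (70) p.273] -/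
theorem sum_side_eq {d : ℕ} (n : ℕ) {μ ν : Fin d} (hμν : μ ≠ ν) : ∑ κ, side n μ ν κ = (d + 2) * n := by
  classical
  have h : ∀ κ, side n μ ν κ = n + (if κ = μ then n else 0) + (if κ = ν then n else 0) := by
    intro κ
    unfold side
    by_cases h1 : κ = μ
    · subst h1; simp [hμν]; ring
    · by_cases h2 : κ = ν
      · subst h2; simp [h1]; ring
      · simp [h1, h2]
  simp_rw [h]
  rw [Finset.sum_add_distrib, Finset.sum_add_distrib, Finset.sum_const, Finset.card_univ, Fintype.card_fin,
    Finset.sum_ite_eq' Finset.univ μ, Finset.sum_ite_eq' Finset.univ ν]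
  simp only [Finset.mem_univ, if_true, smul_eq_mul]
  ring

/-- **COORDINATES OF THE COVER**: a fine site lies in `Δ′(p′)` (its `j`-block is a corner of `p′`, `Carriers.plaqCover`) iff its labels are `(p′.src)_κ·L^j + a_κ` with
`0 ≤ a_κ < side_κ` (`B10Eq70Squaring.side`: `2L^j` in the directions of `p′`, `L^j` otherwise) — `Δ′(p′)` is the product box of (70) based at the LOWER CORNER of `B^j(p′.src)`.
[cite: Balaban1985UV3, (69)–(70) p.273] -/
theorem mem_plaqCover_iff_exists_offset (hj : j ≤ P.m + P.K) (p : Plaq P j) (x : Site P 0) :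
    x ∈ plaqCover p ↔ ∃ a : Fin P.d → ℕ, (∀ κ, a κ < side (P.L ^ j) p.μ p.ν κ) ∧
      ∀ κ, x κ = ((((p.src κ).val * P.L ^ j + a κ : ℕ)) : ZMod (P.sitesPerDir 0)) := by
  have hLj : 0 < P.L ^ j := pow_pos P.L_pos j
  have hN : P.sitesPerDir 0 = P.sitesPerDir j * P.L ^ j :=
    Literature.MathematicalPhysics.QuantumFieldTheory.BalabanImbrieJaffe1984to88.BIJ85Ineq722Torus.sitesPerDir_zero_eq hj
  constructor
  · intro hx
    obtain ⟨εμ, εν, hεμ, hεν, hc⟩ := corner_eq_add p (c := coarsen j x) hx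
    refine ⟨fun κ => (x κ).val % P.L ^ j + (if κ = p.μ then εμ else if κ = p.ν then εν else 0) * P.L ^ j, fun κ => ?_, fun κ => ?_⟩
    · dsimp only
      have hmod : (x κ).val % P.L ^ j < P.L ^ j := Nat.mod_lt _ hLj
      by_cases h1 : κ = p.μ
      · have hs : side (P.L ^ j) p.μ p.ν κ = 2 * P.L ^ j := by unfold side; rw [if_pos (Or.inl h1)]
        rw [hs, if_pos h1]; nlinarith
      · by_cases h2 : κ = p.ν
        · have hs : side (P.L ^ j) p.μ p.ν κ = 2 * P.L ^ j := by unfold side; rw [if_pos (Or.inr h2)]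
          rw [hs, if_neg h1, if_pos h2]; nlinarith
        · have hs : side (P.L ^ j) p.μ p.ν κ = P.L ^ j := by unfold side; rw [if_neg (not_or.mpr ⟨h1, h2⟩)]
          rw [hs, if_neg h1, if_neg h2]; omega
    · -- `x_κ = L^j·⌊x_κ∕L^j⌋ + x_κ mod L^j`, `⌊x_κ∕L^j⌋ = label of the corner ≡ (p′.src)_κ + ε_κ (mod sitesPerDir j)`
      dsimp only
      set ε : ℕ := if κ = p.μ then εμ else if κ = p.ν then εν else 0 with hε
      have hval : (x κ).val / P.L ^ j = ((coarsen j x) κ).val := (val_coarsen j hj x κ).symm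
      have hcκ : ((((coarsen j x) κ).val : ℕ) : ZMod (P.sitesPerDir j)) = ((((p.src κ).val + ε : ℕ)) : ZMod (P.sitesPerDir j)) := by
        rw [ZMod.natCast_zmod_val, hc κ, Nat.cast_add, ZMod.natCast_zmod_val]
      have hmodeq : ((coarsen j x) κ).val * P.L ^ j ≡ ((p.src κ).val + ε) * P.L ^ j [MOD P.sitesPerDir 0] := by
        rw [hN]
        exact Nat.ModEq.mul_right' _ ((ZMod.natCast_eq_natCast_iff _ _ _).mp hcκ)
      calc x κ = ((((x κ).val : ℕ)) : ZMod (P.sitesPerDir 0)) := (ZMod.natCast_zmod_val _).symm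
        _ = (((((coarsen j x) κ).val * P.L ^ j + (x κ).val % P.L ^ j : ℕ)) : ZMod (P.sitesPerDir 0)) := by
            congr 1; rw [← hval, mul_comm]; exact (Nat.div_add_mod _ _).symm
        _ = (((((p.src κ).val + ε) * P.L ^ j + (x κ).val % P.L ^ j : ℕ)) : ZMod (P.sitesPerDir 0)) := by
            rw [Nat.cast_add, Nat.cast_add, (ZMod.natCast_eq_natCast_iff _ _ _).mpr hmodeq]
        _ = ((((p.src κ).val * P.L ^ j + ((x κ).val % P.L ^ j + ε * P.L ^ j) : ℕ)) : ZMod (P.sitesPerDir 0)) := by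
            congr 1; ring
  · rintro ⟨a, ha, hx⟩
    -- `x` is the projection of the integer site `L^j·z(p′) + a ∈ Δ′`
    set y : B7Prop1Explicit.Site P.d := fun κ => ((P.L ^ j : ℕ) : ℤ) * (((p.src κ).val : ℕ) : ℤ) + (a κ : ℤ) with hy_def
    have hy : y ∈ deltaBox (P.L ^ j) ((P.L ^ j : ℕ) • zOf p) p.μ p.ν := by
      rw [mem_deltaBox]
      intro κ
      have haκ : ((a κ : ℕ) : ℤ) < side (P.L ^ j) p.μ p.ν κ := by exact_mod_cast ha κ
      simp only [hy_def, Pi.sub_apply, nsmul_eq_mul, Pi.mul_apply, Pi.natCast_apply, zOf_apply]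
      constructor
      · linarith [Int.natCast_nonneg (a κ)]
      · linarith
    have hxy : x = projSite y := by
      funext κ
      rw [hx κ, projSite_apply, hy_def]
      push_cast
      ring
    rw [hxy]
    exact projSite_mem_plaqCover hj p hy

/-- Every side of the box is at most `2L^j`. [cite: Balaban1985UV3, (70) p.273] -/
theorem side_le {d : ℕ} (n : ℕ) (μ ν κ : Fin d) : side n μ ν κ ≤ 2 * n := by
  unfold side; split_ifs <;> omega

/-- `2L^j ≤ (sitesPerDir 0)∕2 = L^{m+K}` for `j < m + K`. [folklore] -/
theorem two_mul_pow_le_half_sitesPerDir_zero (hj : j + 1 ≤ P.m + P.K) : 2 * P.L ^ j ≤ P.sitesPerDir 0 / 2 := by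
  have hle : P.L ^ (j + 1) ≤ P.L ^ (P.m + P.K) := Nat.pow_le_pow_right P.L_pos hj
  have h2 : 2 * P.L ^ j ≤ P.L ^ (j + 1) := by rw [pow_succ]; nlinarith [pow_pos P.L_pos j, P.hL.2]
  unfold Params.sitesPerDir
  rw [Nat.sub_zero, Nat.mul_div_cancel_left _ (by norm_num : 0 < 2)]
  omega

/-- `2L^j < sitesPerDir 0` for `j < m + K`. [folklore] -/
theorem two_mul_pow_lt_sitesPerDir_zero (hj : j + 1 ≤ P.m + P.K) : 2 * P.L ^ j < P.sitesPerDir 0 := by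
  have h := two_mul_pow_le_half_sitesPerDir_zero hj
  have hpos : 0 < P.sitesPerDir 0 := Nat.pos_of_ne_zero (P.sitesPerDir_ne_zero 0)
  omega

/-- Offsets are unique: two labels `≤ 2L^j < sitesPerDir 0` that agree modulo `sitesPerDir 0` are equal. [folklore] -/
theorem offset_unique (hj : j + 1 ≤ P.m + P.K) {a a' : ℕ} (ha : a ≤ 2 * P.L ^ j) (ha' : a' ≤ 2 * P.L ^ j)
    (h : ((a : ℕ) : ZMod (P.sitesPerDir 0)) = ((a' : ℕ) : ZMod (P.sitesPerDir 0))) : a = a' := by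
  have h2 := two_mul_pow_lt_sitesPerDir_zero hj
  have hmod := (ZMod.natCast_eq_natCast_iff' _ _ _).mp h
  rwa [Nat.mod_eq_of_lt (by omega), Nat.mod_eq_of_lt (by omega)] at hmod

/-- **FINE PLAQUETTES OVER THE COVER, BY OFFSETS** (for piece (iv): the rigid flux family of piece (i) is given by offsets): a fine plaquette whose base point has offsets
`a_κ` from the lower corner of `Δ′(p′)` with `a_κ + 1 < side_κ` in its two directions and `a_κ < side_κ` in the others has all four corners in `Δ′(p′)`, i.e. lies in
`plaqsIn 0 (plaqCover p′)`. [cite: Balaban1985UV3, (69)–(70) p.273] -/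
theorem mem_plaqsIn_cover_of_offset (hj : j ≤ P.m + P.K) (p : Plaq P j) (q : Plaq P 0) (a : Fin P.d → ℕ)
    (hq : ∀ κ, q.src κ = ((((p.src κ).val * P.L ^ j + a κ : ℕ)) : ZMod (P.sitesPerDir 0)))
    (ha : ∀ κ, a κ + (if κ = q.μ ∨ κ = q.ν then 1 else 0) < side (P.L ^ j) p.μ p.ν κ) :
    q ∈ plaqsIn 0 (plaqCover p) := by
  rw [mem_plaqsIn_iff]
  have hμν : q.μ ≠ q.ν := ne_of_lt q.hμν
  have key : ∀ (εμ εν : ℕ), εμ ≤ 1 → εν ≤ 1 → ∀ z : Site P 0,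
      (∀ κ, z κ = q.src κ + ((if κ = q.μ then εμ else if κ = q.ν then εν else 0 : ℕ) : ZMod (P.sitesPerDir 0))) → z ∈ plaqCover p := by
    intro εμ εν hεμ hεν z hz
    refine (mem_plaqCover_iff_exists_offset hj p z).mpr
      ⟨fun κ => a κ + (if κ = q.μ then εμ else if κ = q.ν then εν else 0), fun κ => ?_, fun κ => ?_⟩
    · have h := ha κ
      dsimp only
      by_cases h1 : κ = q.μ
      · rw [if_pos (Or.inl h1)] at h; rw [if_pos h1]; omega
      · by_cases h2 : κ = q.ν
        · rw [if_pos (Or.inr h2)] at h; rw [if_neg h1, if_pos h2]; omega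
        · rw [if_neg (not_or.mpr ⟨h1, h2⟩)] at h; rw [if_neg h1, if_neg h2]; omega
    · rw [hz κ, hq κ]; push_cast; ring
  intro z hz
  simp only [cornerSet, toFine_zero, Set.mem_insert_iff, Set.mem_singleton_iff] at hz
  rcases hz with rfl | rfl | rfl | rfl
  · exact key 0 0 zero_le_one zero_le_one _ fun κ => by simp
  · refine key 1 0 le_rfl zero_le_one _ fun κ => ?_
    simp only [Site.shift_apply]
    by_cases h1 : κ = q.μ
    · subst h1; simp
    · simp [h1]
  · refine key 0 1 zero_le_one le_rfl _ fun κ => ?_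
    simp only [Site.shift_apply]
    by_cases h1 : κ = q.ν
    · subst h1; simp [hμν.symm]
    · by_cases h2 : κ = q.μ
      · subst h2; simp [hμν]
      · simp [h1, h2]
  · refine key 1 1 le_rfl le_rfl _ fun κ => ?_
    simp only [Site.shift_apply]
    by_cases h1 : κ = q.ν
    · subst h1; simp [hμν.symm]
    · by_cases h2 : κ = q.μ
      · subst h2; simp [hμν]
      · simp [h1, h2]

/-! ## §2 The bonds under `p′` are closed under the exact (0.4) dependency; locality of the `j`-fold averages over the cover -/

/-- **THE BONDS OVER THE COVER ARE DEPENDENCY-CLOSED**: the family «bonds of level `s ≤ j` whose two fine representatives lie in `Δ′(p′)`» is closed under the exact (0.4)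
dependency `Feeds₂` (`Δ′(p′)` is a union of `j`-blocks, hence of `s`-blocks for every `s ≤ j`). [cite: Balaban1985Averaging, p.24 and p.26] -/
theorem depClosed₂_coverBonds (hj : j ≤ P.m + P.K) (p : Plaq P j) :
    DepClosed₂ (fun s => {b : PBond P s | s ≤ j ∧ toFine s b.src ∈ plaqCover p ∧ toFine s b.tgt ∈ plaqCover p}) := by
  intro s c hc b hb
  obtain ⟨hsj, hsrc, htgt⟩ := hc
  have hs1 : s + 1 ≤ P.m + P.K := hsj.trans hj
  have hs0 : s ≤ P.m + P.K := (Nat.le_succ s).trans hs1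
  have key : ∀ (z : Site P s) (y : Site P (s + 1)), blockOf z = y → coarsen j (toFine s z) = coarsen j (toFine (s + 1) y) := by
    intro z y hzy
    refine coarsen_eq_of_coarsen_eq (j' := s + 1) ?_ hsj
    rw [coarsen_succ, coarsen_toFine s hs0, hzy, coarsen_toFine (s + 1) hs1]
  have mem_of : ∀ z : Site P s, (blockOf z = c.src ∨ blockOf z = c.tgt) → toFine s z ∈ plaqCover p := by
    intro z hz
    rcases hz with hz | hz
    · have h := key z c.src hz
      simp only [plaqCover, Set.mem_setOf_eq, h] at hsrc ⊢
      exact hsrc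
    · have h := key z c.tgt hz
      simp only [plaqCover, Set.mem_setOf_eq, h] at htgt ⊢
      exact htgt
  exact ⟨(Nat.le_succ s).trans hsj, mem_of b.src hb.1, mem_of b.tgt hb.2⟩

/-- **LOCALITY OVER THE COVER**: two finest-lattice configurations that agree on the bonds with both ends in `Δ′(p′)` have the same `s`-fold averages (`s ≤ j`, any `LoopAverage`)
at every level-`s` bond whose fine representatives lie in `Δ′(p′)`. [cite: Balaban1985Averaging, p.24 and p.26] -/
theorem iter_eq_of_eqOn_cover {G : Type*} [GaugeGroup G] (ℰ : LoopAverage G) (hj : j ≤ P.m + P.K) (p : Plaq P j)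
    {U U' : GaugeField P 0 G} (hUU' : ∀ b : PBond P 0, b.src ∈ plaqCover p → b.tgt ∈ plaqCover p → U b = U' b)
    {s : ℕ} (hs : s ≤ j) {c : PBond P s} (hsrc : toFine s c.src ∈ plaqCover p) (htgt : toFine s c.tgt ∈ plaqCover p) :
    Averaging.iter (fun i => (blockAvg ℰ : Averaging P i G)) s U c = Averaging.iter (fun i => (blockAvg ℰ : Averaging P i G)) s U' c :=
  iter_blockAvg_local₂ ℰ (depClosed₂_coverBonds hj p) s (hs.trans hj) U U' (fun b hb => hUU' b hb.2.1 hb.2.2) c ⟨hs, hsrc, htgt⟩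

/-- **LOCALITY OF THE AVERAGED PLAQUETTE**: two finest-lattice configurations that agree on the bonds with both ends in `Δ′(p′)` have the same `j`-fold averaged plaquette
variable `Ū^{(j)}(∂p′)` — «it is enough to assume (52) for `p ⊂ B^k(x) ∪ B^k(y) ∪ B^k(z) ∪ B^k(w)`». [cite: Balaban1985Averaging, p.26] -/
theorem plaqHol_iter_eq_of_eqOn_cover {G : Type*} [GaugeGroup G] (ℰ : LoopAverage G) (hj : j ≤ P.m + P.K) (p : Plaq P j)
    {U U' : GaugeField P 0 G} (hUU' : ∀ b : PBond P 0, b.src ∈ plaqCover p → b.tgt ∈ plaqCover p → U b = U' b) :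
    GaugeField.plaqHol (Averaging.iter (fun i => (blockAvg ℰ : Averaging P i G)) j U) p =
      GaugeField.plaqHol (Averaging.iter (fun i => (blockAvg ℰ : Averaging P i G)) j U') p := by
  have hc := cornerSet_subset_plaqCover hj p
  have h1 : toFine j p.src ∈ plaqCover p := hc (by simp [cornerSet])
  have h2 : toFine j (p.src.shift p.μ) ∈ plaqCover p := hc (by simp [cornerSet])
  have h3 : toFine j (p.src.shift p.ν) ∈ plaqCover p := hc (by simp [cornerSet])
  have h4 : toFine j ((p.src.shift p.μ).shift p.ν) ∈ plaqCover p := hc (by simp [cornerSet])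
  have h4' : toFine j ((p.src.shift p.ν).shift p.μ) ∈ plaqCover p := by rw [← Site.shift_comm]; exact h4
  unfold GaugeField.plaqHol
  rw [iter_eq_of_eqOn_cover ℰ hj p hUU' le_rfl (c := ⟨p.src, p.μ⟩) h1 h2,
    iter_eq_of_eqOn_cover ℰ hj p hUU' le_rfl (c := ⟨p.src.shift p.μ, p.ν⟩) h2 h4,
    iter_eq_of_eqOn_cover ℰ hj p hUU' le_rfl (c := ⟨p.src.shift p.ν, p.μ⟩) h3 h4',
    iter_eq_of_eqOn_cover ℰ hj p hUU' le_rfl (c := ⟨p.src, p.ν⟩) h1 h3]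

end Summit.QuantumFields.YangMills.Theorems.SymAvgCover

end
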